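import Mathlib
import Summits.ResolutionOfSingularities.ResolutionOfSingularities.Theorems.WeightedInvariantELadderOneStage
import Summits.ResolutionOfSingularities.ResolutionOfSingularities.Theorems.WeightedInvariantELadderOneStageInv
import Summits.ResolutionOfSingularities.ResolutionOfSingularities.Theorems.WeightedInvariantELadderOneMeasure
import Summits.ResolutionOfSingularities.ResolutionOfSingularities.Theorems.WeightedInvariantELadderOneOverMaxSing
import Summits.ResolutionOfSingularities.ResolutionOfSingularities.Theorems.WeightedInvariantELadderOneOrbitOfDim
import Summits.ResolutionOfSingularities.ResolutionOfSingularities.Theorems.WeightedInvariantELadderOneRegOfDim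
import Summits.ResolutionOfSingularities.ResolutionOfSingularities.Theorems.WeightedInvariantStrictTransformDimension
import Summits.ResolutionOfSingularities.ResolutionOfSingularities.Theorems.WeightedInvariantELadderOneSingOffCentre
import Summits.ResolutionOfSingularities.ResolutionOfSingularities.Theorems.WeightedInvariantHypersurfaceAdmissibleSequences
import HarnessLib

/-!
# Rung `e = 1`: the successor stage satisfies `Inv'` and the measure drops (`stub_e1_inv_succ`)

Route `ResolutionOfSingularities/WeightedInvariant`, door crux `HypersurfaceCentreConstruction`
(stmt-ResolutionOfSingularities-19897), e-ladder `e = 1` of `res-L1-w43-stub-10` (cell res-hironaka), registered stub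
`stub_e1_inv_succ` of door skeleton v3.5.1 (`(S) (hInv : S.Inv') … : S'.Inv' ∧ S'.mu < S.mu`).  This file is the
ASSEMBLY of that stub from the landed helpers, modulo ONE remaining input stated as a hypothesis:

  (M5) `∀ η' ∈ singImage (σˢ(ker i)), σ₊ η' ∉ supp R → σ₊ η' ∈ singImage (ker i)` — OFF the centre the singular
  points of the strict transform lie over singular points (the trivial end `B₋ = (Y ∖ supp) × 𝔾ₘ` of the cobordism;
  ring level landed by res-D-pv-023 AS type-o7, `Theorems/WeightedInvariantELadderOneTrivialEndRing.lean`); over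
  the centre `support = singImage` does it.

`ELadderOne.stub_e1_inv_succ_of_singOverSupport`: given (M5) for the Rees filtration at hand, the registered
conclusion holds; `ELadderOne.stub_e1_inv_succ` — THE REGISTERED STUB (door skeleton v3.5.1), with (M5) discharged by
`ELadderOne.piPlus_mem_singImage_of_not_mem_support` (`Theorems/WeightedInvariantELadderOneSingOffCentre.lean`).  Ingredients: (I0′) `dim X′ = dim X + 1 = j + 2` (res-type-076, p514887
`StrictTransformDimension.topologicalKrullDim_strictTransformPlus`); `Inv'` from (I0′) alone (`Stage.inv'_of_invDim`,
p516160 ∘ p515116); the hover map `maxSing S' → maxSing S` (`Stage.piPlus_mem_maxSing`, p513385, read on a unit chart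
of the OLD stage with (I2w) from `hInv.invOrbit`); the drop (`Stage.mu_lt_mu_of_maps_to`, p508621, with `hdrop`).

Nothing here is a claim about Hironaka's problem; AI-written, weaker than expert review.
-/

noncomputable section

set_option linter.dupNamespace false -- mandated namespace of this single-conjunct summit

open CategoryTheory AlgebraicGeometry TopologicalSpace IsLocalRing
open Literature.AlgebraicGeometry.Resolution
open Summit.ResolutionOfSingularities.ResolutionOfSingularities.Theorems

namespace Summit.ResolutionOfSingularities.ResolutionOfSingularities.Theorems.ELadderOne

variable {k : Type} [Field k]

/-- **`stub_e1_inv_succ` modulo (M5).**  For a singular stage `S` with `Inv'`, an admissible centre `R` with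
`support = singImage`, its Rees filtration `R'` with the order drop over the maximal singular points, and any
presentation data of the successor (strict transform `X' ⊆ B₊`, quotient `q' : X' ⟶ V'`, graded atlas `𝒜'` of rank
`j + 1`): IF the singular points of `X'` lie over the singular image of `X` (M5), then the successor stage satisfies
`Inv'` and `mu` drops.  (I0′): `dim X' = dim X + 1`; `Inv'` from (I0′); hover on a unit chart of `S`; drop.)
[folklore] -/
theorem stub_e1_inv_succ_of_singOverSupport (S : Stage k) (hInv : S.Inv') (hsing : ¬ Scheme.IsRegular S.X)
    (R : ReesAlgebraData S.Y) (hadm : IsAdmissibleCentre S.f S.i.ker R)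
    (hsupp : R.support = singImage S.i.ker)
    (R' : ReesFiltration S.Y) (hR' : R'.ideal = R.piece)
    (hM5 : ∀ η' : ↥R'.plus, η' ∈ singImage (R'.strictTransformPlus S.i.ker) →
      R'.πPlus η' ∉ R.support → R'.πPlus η' ∈ singImage S.i.ker)
    (hdrop : ∀ b : ↥R'.plus, R'.πPlus b ∈ S.maxSing →
      idealOrder (R'.strictTransformPlus S.i.ker) b < idealOrder S.i.ker (R'.πPlus b))
    [Smooth (R'.πPlus ≫ S.f)] [IsSeparated (R'.πPlus ≫ S.f)] [QuasiCompact (R'.πPlus ≫ S.f)]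
    [IsIntegral (R'.strictTransformPlus S.i.ker).subscheme]
    (hlp' : IsLocallyPrincipal (R'.strictTransformPlus S.i.ker).subschemeι.ker)
    (V' : Scheme.{0}) (ρ : V' ⟶ S.V) [IsIntegral V'] [IsProper ρ]
    (q' : (R'.strictTransformPlus S.i.ker).subscheme ⟶ V')
    (hq' : q' ≫ ρ ≫ S.g = (R'.strictTransformPlus S.i.ker).subschemeι ≫ R'.πPlus ≫ S.f)
    (𝒜' : GradedAtlas (S.j + 1) (R'.πPlus ≫ S.f) (R'.strictTransformPlus S.i.ker).subschemeι q') :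
    (⟨R'.plus, R'.πPlus ≫ S.f, (R'.strictTransformPlus S.i.ker).subscheme,
        (R'.strictTransformPlus S.i.ker).subschemeι, hlp', V', q', ρ ≫ S.g, hq', S.j + 1, 𝒜'⟩ : Stage k).Inv' ∧
      (⟨R'.plus, R'.πPlus ≫ S.f, (R'.strictTransformPlus S.i.ker).subscheme,
        (R'.strictTransformPlus S.i.ker).subschemeι, hlp', V', q', ρ ≫ S.g, hq', S.j + 1, 𝒜'⟩ : Stage k).mu < S.mu := by
  -- the successor stage
  set S' : Stage k := ⟨R'.plus, R'.πPlus ≫ S.f, (R'.strictTransformPlus S.i.ker).subscheme,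
        (R'.strictTransformPlus S.i.ker).subschemeι, hlp', V', q', ρ ≫ S.g, hq', S.j + 1, 𝒜'⟩ with hS'def
  have hc : R.IsRegularWeightedCentre := hadm.1
  -- the ideal of the successor hypersurface is the strict transform
  have hker' : S'.i.ker = R'.strictTransformPlus S.i.ker := Scheme.IdealSheafData.ker_subschemeι _
  -- the generic point of `X` is off the centre (support = singular image; the function field is regular)
  have hξ : S.i (genericPoint S.X) ∉ R.support := by
    rw [hsupp]
    rintro ⟨x', hx', hnreg⟩
    obtain ⟨x₀, rfl⟩ := S.i.toImage.surjective x'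
    rw [toImage_apply_eq_iff] at hx'
    obtain rfl : x₀ = genericPoint S.X := S.i.isClosedEmbedding.injective hx'
    exact hnreg ((isRegularLocalRing_stalk_image_iff S.i (genericPoint S.X)).mpr
      (inferInstanceAs (IsRegularLocalRing S.X.functionField)))
  -- (I0′): `dim X' = dim X + 1 = j + 2`
  have h0' : S'.InvDim := by
    change topologicalKrullDim ↥(R'.strictTransformPlus S.i.ker).subscheme = ((S.j + 1 + 1 : ℕ) : WithBot ℕ∞)
    rw [StrictTransformDimension.topologicalKrullDim_strictTransformPlus S.f S.i R hc hξ R' hR', hInv.invDim]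
    push_cast
    ring
  -- `Inv'` of the successor from (I0′) alone
  have hInv' : S'.Inv' := S'.inv'_of_invDim h0'
  refine ⟨hInv', ?_⟩
  -- the pieces of the centre are homogeneous on the charts of the atlas ((hom) of the admissible centre)
  have hH := hadm.2.2
  have hhom : ∀ (a : S.atlas.ι) (n : ℕ), @Ideal.IsHomogeneous (Fin S.j → ℤ)
      (AddSubgroup Γ(S.Y, S.atlas.W a)) Γ(S.Y, S.atlas.W a) _ _ _ (S.atlas.piece a) _ _
      (S.atlas.gradedRing a) ((R.piece n).ideal (S.atlas.W a)) := fun a n =>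
    @hH S.j (S.atlas.W a) (S.atlas.piece a) (S.atlas.gradedRing a) (S.atlas.appLE_mem a)
      (S.atlas.isHomogeneous_ker a) n
  -- hover: maximal singular points of `S'` lie over maximal singular points of `S`
  have hover : ∀ η' ∈ S'.maxSing, R'.πPlus.base η' ∈ S.maxSing := by
    intro η' hη'
    have hη'₁ : η' ∈ singImage (R'.strictTransformPlus S.i.ker) := by
      have h := hη'.1
      rwa [hker'] at h
    have hη'₂ : ∀ z ∈ singImage (R'.strictTransformPlus S.i.ker),
        η' ∈ closure ({z} : Set ↥R'.plus) → z = η' := by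
      have h := hη'.2
      rwa [hker'] at h
    have hy : R'.πPlus η' ∈ singImage S.i.ker := by
      by_cases hys : R'.πPlus η' ∈ R.support
      · rwa [hsupp] at hys
      · exact hM5 η' hη'₁ hys
    obtain ⟨x, hx⟩ := Stage.mem_range_of_mem_singImage S hy
    obtain ⟨a, hxa, ha⟩ := S.exists_isUnitChart x
    have hya : R'.πPlus η' ∈ (S.atlas.W a : S.Y.Opens) := hx ▸ hxa
    exact Stage.piPlus_mem_maxSing S R hc hhom R' hR' (a := a)
      (fun η hη hηa => (hInv.invOrbit a ha η hη hηa).2) η' hη'₁ hη'₂ hy hya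
  -- the drop
  refine Stage.mu_lt_mu_of_maps_to S S' hsing (fun b => R'.πPlus.base b) hover ?_
  intro η' hη'
  have h := hdrop η' (hover η' hη')
  change idealOrder S'.i.ker η' < _
  rwa [hker']

/-- **`stub_e1_inv_succ`** — registered stub of door skeleton v3.5.1 (crux `HypersurfaceCentreConstruction`,
stmt-ResolutionOfSingularities-19897, e-ladder `e = 1`): for a singular stage `S` with `Inv'`, an admissible centre
`R` with `support = singImage` and the order drop over the maximal singular points, and any presentation data of the
successor (strict transform `X' ⊆ B₊`, quotient `q'`, graded atlas of rank `j + 1`), **the successor stage satisfies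
`Inv'` and `mu` drops**: (M5) `ELadderOne.piPlus_mem_singImage_of_not_mem_support` discharges the hypothesis of
`stub_e1_inv_succ_of_singOverSupport`. [folklore] -/
theorem stub_e1_inv_succ (S : Stage k) (hInv : S.Inv') (hsing : ¬ Scheme.IsRegular S.X)
    (R : ReesAlgebraData S.Y) (hadm : IsAdmissibleCentre S.f S.i.ker R)
    (hsupp : R.support = singImage S.i.ker)
    (R' : ReesFiltration S.Y) (hR' : R'.ideal = R.piece)
    (hdrop : ∀ b : ↥R'.plus, R'.πPlus b ∈ S.maxSing →
      idealOrder (R'.strictTransformPlus S.i.ker) b < idealOrder S.i.ker (R'.πPlus b))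
    [Smooth (R'.πPlus ≫ S.f)] [IsSeparated (R'.πPlus ≫ S.f)] [QuasiCompact (R'.πPlus ≫ S.f)]
    [IsIntegral (R'.strictTransformPlus S.i.ker).subscheme]
    (hlp' : IsLocallyPrincipal (R'.strictTransformPlus S.i.ker).subschemeι.ker)
    (V' : Scheme.{0}) (ρ : V' ⟶ S.V) [IsIntegral V'] [IsProper ρ]
    (q' : (R'.strictTransformPlus S.i.ker).subscheme ⟶ V')
    (hq' : q' ≫ ρ ≫ S.g = (R'.strictTransformPlus S.i.ker).subschemeι ≫ R'.πPlus ≫ S.f)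
    (𝒜' : GradedAtlas (S.j + 1) (R'.πPlus ≫ S.f) (R'.strictTransformPlus S.i.ker).subschemeι q') :
    (⟨R'.plus, R'.πPlus ≫ S.f, (R'.strictTransformPlus S.i.ker).subscheme,
        (R'.strictTransformPlus S.i.ker).subschemeι, hlp', V', q', ρ ≫ S.g, hq', S.j + 1, 𝒜'⟩ : Stage k).Inv' ∧
      (⟨R'.plus, R'.πPlus ≫ S.f, (R'.strictTransformPlus S.i.ker).subscheme,
        (R'.strictTransformPlus S.i.ker).subschemeι, hlp', V', q', ρ ≫ S.g, hq', S.j + 1, 𝒜'⟩ : Stage k).mu < S.mu :=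
  stub_e1_inv_succ_of_singOverSupport S hInv hsing R hadm hsupp R' hR'
    (fun η' h₁ h₂ => piPlus_mem_singImage_of_not_mem_support S.f S.i R hadm.1 R' hR' η' h₁ h₂)
    hdrop hlp' V' ρ q' hq' 𝒜'

end Summit.ResolutionOfSingularities.ResolutionOfSingularities.Theorems.ELadderOne

end
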